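import Summits.BirchSwinnertonDyer.BirchSwinnertonDyer.Theorems.ManinLocalTwoThreeKatoFactTwoAtPeriodRatio
import Summits.BirchSwinnertonDyer.BirchSwinnertonDyer.Theorems.ManinLocalTwoThreeKatoFactThreeAtPeriodRatio
import Summits.BirchSwinnertonDyer.Rank1Residual.ManinAdditive.SupersingularShadowMoment
import HarnessLib

/-!
# CM period domination transports Kato integrality from the strong Weil curve to every CM member (es g28; MEMO-es §42.3)

BY NAME: the conjecture nodes `KatoCurve.ShadowMoment.CMPeriodDominationTwo` / `CMPeriodDominationThree`
(E-es-129-T2 / T3, landed p709390) composed with the transport theorems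
`katoFactTwoAt_of_isIsogenous_of_realPeriod_ratio` (p702793) / `katoFactThreeAt_of_isIsogenous_of_period_ratios` (p703560):
«T2 ∧ `KatoFactTwoAt` at an optimal globally-minimal model `W`» ⟹ `KatoFactTwoAt V f` for every globally minimal `j = 1728`
member `V` of the class, off conductor 32; the p = 3 twin off conductor 27.  Route-independent.  Sorry-free; the conjecture
nodes enter as HYPOTHESES; nothing about BSD / the Manin constant / C2 / C3 is proved here.

Landed by the C2/C3 LEAD (p1 gen 13) from es g28's `Consume-es-g28-byname.lean` verbatim (typer g18: «yours to land next to p708387»);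
these are the CM (`j = 1728` / `j = 0`) instances of the period-domination excuse of skeleton v21's stub 6♭‴ and of C3's Kato transport.
bears_on: stmt-BirchSwinnertonDyer-22967 (C2), stmt-BirchSwinnertonDyer-22968 (C3).  BSD is not proved by this; C2/C3 OPEN.
-/

set_option autoImplicit false
set_option linter.dupNamespace false

noncomputable section

open scoped MatrixGroups ModularForm
open CongruenceSubgroup WeierstrassCurve Literature.NumberTheory.EllipticCurves
  Literature.NumberTheory.EllipticCurves.ModularForms
  Summit.BirchSwinnertonDyer.Rank1Residual.ManinAdditive.KatoCurve.ShadowMoment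

namespace Summit.BirchSwinnertonDyer.BirchSwinnertonDyer.Theorems.ManinLocalTwoThree

/-- **E-es-124 off 32a from T2 + Kato at the strong Weil curve.**  If CM period domination at `2` holds (`CMPeriodDominationTwo`,
E-es-129-T2, OPEN) then Kato–Néron integrality at `p = 2` (`KatoFactTwoAt`) passes from an optimal globally minimal model `W` of
conductor `≠ 32` to every globally minimal `j = 1728` member `V` of its class at `4 ∣ N`, by the lead's odd-period-ratio transport
`katoFactTwoAt_of_isIsogenous_of_realPeriod_ratio`.  CONDITIONAL on the conjecture node. -/
theorem katoFactTwoAt_of_cmPeriodDominationTwo (hdom : CMPeriodDominationTwo)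
    (V W : WeierstrassCurve ℚ) [V.IsElliptic] [V.IsGloballyMinimal] [W.IsElliptic] [W.IsGloballyMinimal]
    {N : ℕ} [NeZero N] (f : CuspForm (Gamma0 N) 2) (h4 : 2 ^ 2 ∣ N) (hj : V.j = 1728)
    (hW : IsOptimalModel W) (hiso : WeierstrassCurve.IsIsogenous W V) (hN : W.conductorNorm ℤ ≠ 32)
    (hK : KatoFactTwoAt W f) : KatoFactTwoAt V f := by
  obtain ⟨q, m, hq, hΩ⟩ := hdom V W hj hW hiso hN
  exact katoFactTwoAt_of_isIsogenous_of_realPeriod_ratio V W f h4 hiso q m hq hΩ hK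

/-- **E-es-125 off 27a from T3 + Kato₃ at the strong Weil curve.**  If CM period domination at `3` holds (`CMPeriodDominationThree`,
E-es-129-T3, OPEN) then `KatoFactThreeAt` passes from an optimal globally minimal model `W` of conductor `≠ 27` to every globally
minimal `j = 0` member `V` of its class at `9 ∣ N`, by `katoFactThreeAt_of_isIsogenous_of_period_ratios` (real and imaginary
prime-to-`3` period ratios).  CONDITIONAL on the conjecture node. -/
theorem katoFactThreeAt_of_cmPeriodDominationThree (hdom : CMPeriodDominationThree)
    (V W : WeierstrassCurve ℚ) [V.IsElliptic] [V.IsGloballyMinimal] [W.IsElliptic] [W.IsGloballyMinimal]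
    {N : ℕ} [NeZero N] (f : CuspForm (Gamma0 N) 2) (h9 : 3 ^ 2 ∣ N) (hj : V.j = 0)
    (hW : IsOptimalModel W) (hiso : WeierstrassCurve.IsIsogenous W V) (hN : W.conductorNorm ℤ ≠ 27)
    (hK : KatoFactThreeAt W f) : KatoFactThreeAt V f := by
  obtain ⟨q, m, q', m', hq, hq', hΩ, hΩ'⟩ := hdom V W hj hW hiso hN
  exact katoFactThreeAt_of_isIsogenous_of_period_ratios V W f h9 hiso q m q' m' hq hq' hΩ hΩ' hK

end Summit.BirchSwinnertonDyer.BirchSwinnertonDyer.Theorems.ManinLocalTwoThree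

end
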